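import Mathlib.Analysis.InnerProductSpace.Projection.Basic
import Mathlib.Analysis.SpecificLimits.Normed
import HarnessLib

/-!
# Distance to the common kernel of two orthogonal projections (abstract Hilbert-space lemma)

Cell `rh-explicit`, seat cc-s2-1 (HOME `run/shared/lean/pub/rh-explicit/`; lead ruling R5-1, PHASE 1, task E2 —
"the Sonin-space distance lemma", `HOME/cc-s2-3/CERT-PLAN.md` §7 (E2)).  First of two files.

**Setting.**  `E` a Hilbert space, `P`, `Q` two orthogonal projections (bounded, idempotent, symmetric), and a
number `0 ≤ Λ < 1` with `‖Q (P x)‖² ≤ Λ ‖P x‖²` for all `x` ("a vector in the range of `P` has at most the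
fraction `Λ` of its energy in the range of `Q`").  In the application (file `SoninDistance`), `E = L²(ℝ)`, `P` is
time-limiting to `[−1, 1]`, `Q` is band-limiting to `[−1, 1]`, `ker P ∩ ker Q` (inside the even functions) is Sonin's
space `S(1,1)` of Connes–Consani, and `Λ` is the certified bound on the top eigenvalue `λ₀` of the prolate
operator `P̂ P P̂` supplied by seat cc-s2-3 (`SoninBandEnergy*`, task E1).

**Theorem** (`exists_mem_ker_inter_ker_norm_sub_sq_le`).  For every `η ∈ ker P` there is `ζ ∈ ker P ∩ ker Q` with
`‖η − ζ‖² ≤ ‖Q η‖² / (1 − Λ)`, and `ζ` is fixed by every bounded operator `R` commuting with `P` and `Q` that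
fixes `η` (used for evenness).  This is the SHARP two-projection constant (`dist(η, ker P ∩ ker Q) ≤
dist(η, ker Q)/√(1 − c²)`, `c ≤ ‖QP‖` the cosine of the Friedrichs angle), obtained WITHOUT spectral theory:
with `T := Q P Q` (`‖T‖ ≤ Λ < 1`) and `u := (1 − T)⁻¹ (Q η)` (Neumann series, Mathlib `Units.oneSub`) one has
`Q u = u`, `(1 − Λ)‖u‖ ≤ ‖Qη‖`, and `ζ := η − u + P u` satisfies `P ζ = 0`, `Q ζ = Qη − u + QPQu = 0`; moreover
`η − ζ = u − Pu` is orthogonal to `ker P ∩ ker Q` (so `ζ` is in fact the orthogonal projection of `η`) and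
`‖u − Pu‖² = Re⟪u, u − Pu⟫ = Re⟪u, η − ζ⟫ = Re⟪u, Qη⟫ ≤ ‖u‖‖Qη‖ ≤ ‖Qη‖²/(1 − Λ)`.
(The cruder Neumann bound `‖η − ζ‖ ≤ ‖u‖ ≤ ‖Qη‖/(1 − Λ)` of the sizing line is thereby improved by the factor
`√(1 − Λ)`, which at `Λ = 1 − 5.72·10⁻⁵` is `132`.)

Proof-only file: no definitions, no named facts, Mathlib only. [folklore]
-/

set_option linter.dupNamespace false  -- the mandated namespace repeats `RiemannHypothesis`

noncomputable section

open ContinuousLinearMap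
open scoped InnerProductSpace

namespace Summit.RiemannHypothesis.RiemannHypothesis.SoninDistance

variable {𝕜 : Type*} [RCLike 𝕜] {E : Type*} [NormedAddCommGroup E] [InnerProductSpace 𝕜 E]

/-! ## Symmetric idempotents -/

/-- For a symmetric idempotent `Q`: `‖Q x‖² = Re⟪x, Q x⟫`. [folklore] -/
theorem norm_sq_eq_re_inner_of_symm_idem (Q : E →L[𝕜] E) (hQ2 : ∀ x, Q (Q x) = Q x)
    (hQs : ∀ x y, ⟪Q x, y⟫_𝕜 = ⟪x, Q y⟫_𝕜) (x : E) :
    ‖Q x‖ ^ 2 = RCLike.re ⟪x, Q x⟫_𝕜 := by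
  rw [← inner_self_eq_norm_sq (𝕜 := 𝕜), ← hQs, hQ2]
  rw [hQs]

/-- For a symmetric idempotent `Q`: `‖Q x‖ ≤ ‖x‖`. [folklore] -/
theorem norm_apply_le_of_symm_idem (Q : E →L[𝕜] E) (hQ2 : ∀ x, Q (Q x) = Q x)
    (hQs : ∀ x y, ⟪Q x, y⟫_𝕜 = ⟪x, Q y⟫_𝕜) (x : E) : ‖Q x‖ ≤ ‖x‖ := by
  have h1 : ‖Q x‖ ^ 2 ≤ ‖x‖ * ‖Q x‖ := by
    rw [norm_sq_eq_re_inner_of_symm_idem Q hQ2 hQs x]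
    exact re_inner_le_norm x (Q x)
  by_cases h0 : ‖Q x‖ = 0
  · rw [h0]; exact norm_nonneg x
  · have hpos : 0 < ‖Q x‖ := lt_of_le_of_ne (norm_nonneg _) (Ne.symm h0)
    nlinarith [h1, hpos]

/-- For symmetric idempotents `P`, `Q`: `‖P (Q y)‖² ≤ ‖Q y‖ · ‖Q (P (Q y))‖`. [folklore] -/
theorem norm_PQ_sq_le (P Q : E →L[𝕜] E) (hP2 : ∀ x, P (P x) = P x)
    (hPs : ∀ x y, ⟪P x, y⟫_𝕜 = ⟪x, P y⟫_𝕜) (hQ2 : ∀ x, Q (Q x) = Q x)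
    (hQs : ∀ x y, ⟪Q x, y⟫_𝕜 = ⟪x, Q y⟫_𝕜) (y : E) :
    ‖P (Q y)‖ ^ 2 ≤ ‖Q y‖ * ‖Q (P (Q y))‖ := by
  rw [norm_sq_eq_re_inner_of_symm_idem P hP2 hPs (Q y)]
  have h : ⟪Q y, P (Q y)⟫_𝕜 = ⟪Q y, Q (P (Q y))⟫_𝕜 := by
    rw [← hQs, hQ2]
  rw [h]
  exact re_inner_le_norm (Q y) (Q (P (Q y)))

/-- **The twisted operator `T = Q P Q` contracts by `Λ` on the range of `Q`**: if `‖Q (P x)‖² ≤ Λ‖P x‖²` for all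
`x`, then `‖Q (P (Q y))‖ ≤ Λ ‖Q y‖` (apply the hypothesis to `x = Q y` and use
`‖P Q y‖² ≤ ‖Q y‖‖Q P Q y‖`). [folklore] -/
theorem norm_QPQ_le (P Q : E →L[𝕜] E) (hP2 : ∀ x, P (P x) = P x)
    (hPs : ∀ x y, ⟪P x, y⟫_𝕜 = ⟪x, P y⟫_𝕜) (hQ2 : ∀ x, Q (Q x) = Q x)
    (hQs : ∀ x y, ⟪Q x, y⟫_𝕜 = ⟪x, Q y⟫_𝕜) {Λ : ℝ} (hΛ0 : 0 ≤ Λ)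
    (hPQ : ∀ x, ‖Q (P x)‖ ^ 2 ≤ Λ * ‖P x‖ ^ 2) (y : E) :
    ‖Q (P (Q y))‖ ≤ Λ * ‖Q y‖ := by
  have h1 : ‖Q (P (Q y))‖ ^ 2 ≤ Λ * ‖P (Q y)‖ ^ 2 := hPQ (Q y)
  have h2 : ‖P (Q y)‖ ^ 2 ≤ ‖Q y‖ * ‖Q (P (Q y))‖ := norm_PQ_sq_le P Q hP2 hPs hQ2 hQs y
  have h3 : ‖Q (P (Q y))‖ ^ 2 ≤ Λ * (‖Q y‖ * ‖Q (P (Q y))‖) :=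
    h1.trans (mul_le_mul_of_nonneg_left h2 hΛ0)
  by_cases h0 : ‖Q (P (Q y))‖ = 0
  · rw [h0]; exact mul_nonneg hΛ0 (norm_nonneg _)
  · have hpos : 0 < ‖Q (P (Q y))‖ := lt_of_le_of_ne (norm_nonneg _) (Ne.symm h0)
    nlinarith [h3, hpos, norm_nonneg (Q y)]

/-! ## The distance lemma -/

variable [CompleteSpace E]

/-- **Distance to the common kernel of two orthogonal projections.**  Let `P`, `Q` be symmetric idempotent
bounded operators on a Hilbert space `E` with `‖Q (P x)‖² ≤ Λ ‖P x‖²` for all `x`, where `0 ≤ Λ < 1`.  Then every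
`η` with `P η = 0` admits `ζ` with `P ζ = 0`, `Q ζ = 0` and `‖η − ζ‖² ≤ ‖Q η‖² / (1 − Λ)`; moreover `ζ` is fixed by
every bounded operator `R` that commutes with `P` and `Q` and fixes `η`.  Construction: `T := QPQ`, `‖T‖ ≤ Λ < 1`,
`u := (1 − T)⁻¹(Qη)` (`Units.oneSub`), `ζ := η − u + Pu`; see the module docstring for the estimate. [folklore] -/
theorem exists_mem_ker_inter_ker_norm_sub_sq_le (P Q : E →L[𝕜] E) (hP2 : ∀ x, P (P x) = P x)
    (hPs : ∀ x y, ⟪P x, y⟫_𝕜 = ⟪x, P y⟫_𝕜) (hQ2 : ∀ x, Q (Q x) = Q x)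
    (hQs : ∀ x y, ⟪Q x, y⟫_𝕜 = ⟪x, Q y⟫_𝕜) {Λ : ℝ} (hΛ0 : 0 ≤ Λ) (hΛ1 : Λ < 1)
    (hPQ : ∀ x, ‖Q (P x)‖ ^ 2 ≤ Λ * ‖P x‖ ^ 2) (η : E) (hη : P η = 0) :
    ∃ ζ : E, P ζ = 0 ∧ Q ζ = 0 ∧ ‖η - ζ‖ ^ 2 ≤ ‖Q η‖ ^ 2 / (1 - Λ) ∧
      ∀ R : E →L[𝕜] E, (∀ x, R (P x) = P (R x)) → (∀ x, R (Q x) = Q (R x)) →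
        R η = η → R ζ = ζ := by
  -- the twisted operator `T = Q P Q` and its norm bound
  set T : E →L[𝕜] E := Q * (P * Q) with hT
  have hTapply : ∀ y, T y = Q (P (Q y)) := fun y => by simp [hT]
  have hTnorm_pt : ∀ y, ‖T y‖ ≤ Λ * ‖y‖ := fun y => by
    rw [hTapply]
    exact (norm_QPQ_le P Q hP2 hPs hQ2 hQs hΛ0 hPQ y).trans
      (mul_le_mul_of_nonneg_left (norm_apply_le_of_symm_idem Q hQ2 hQs y) hΛ0)
  have hTnorm : ‖T‖ < 1 :=
    lt_of_le_of_lt (ContinuousLinearMap.opNorm_le_bound T hΛ0 hTnorm_pt) hΛ1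
  -- `1 - T` is a unit; `u := (1 - T)⁻¹ (Q η)`
  set U : (E →L[𝕜] E)ˣ := Units.oneSub T hTnorm with hU
  have hUval : (U : E →L[𝕜] E) = 1 - T := by rw [hU, Units.val_oneSub]
  set u : E := (↑U⁻¹ : E →L[𝕜] E) (Q η) with hu
  -- the defining identity `u - T u = Q η`
  have hfix : u - T u = Q η := by
    have h1 : ((U : E →L[𝕜] E) * (↑U⁻¹ : E →L[𝕜] E)) (Q η) = Q η := by
      rw [Units.mul_inv, one_apply_eq_self]
    rw [mul_apply_eq_comp, hUval, sub_apply, one_apply_eq_self] at h1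
    exact h1
  have hu_eq : u = Q η + Q (P (Q u)) := by
    rw [← hTapply, ← hfix]; abel
  -- `Q u = u`
  have hQu : Q u = u := by
    conv_lhs => rw [hu_eq]
    rw [map_add, hQ2, hQ2, ← hu_eq]
  -- `(1 - Λ) ‖u‖ ≤ ‖Q η‖`
  have hu_norm : (1 - Λ) * ‖u‖ ≤ ‖Q η‖ := by
    have h1 : ‖u‖ ≤ ‖Q η‖ + ‖T u‖ := by
      calc ‖u‖ = ‖Q η + T u‖ := by rw [← hfix, sub_add_cancel]
        _ ≤ ‖Q η‖ + ‖T u‖ := norm_add_le _ _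
    have h2 : ‖T u‖ ≤ Λ * ‖u‖ := hTnorm_pt u
    linarith
  -- the vector `ζ`
  refine ⟨η - u + P u, ?_, ?_, ?_, ?_⟩
  · -- `P ζ = 0`
    rw [map_add, map_sub, hη, hP2, zero_sub, neg_add_cancel]
  · -- `Q ζ = Q η - u + Q P Q u = 0`
    have h1 : Q (P u) = T u := by rw [hTapply, hQu]
    rw [map_add, map_sub, hQu, h1]
    have h2 : Q η - u + T u = Q η - (u - T u) := by abel
    rw [h2, hfix, sub_self]
  · -- the estimate
    have hdiff : η - (η - u + P u) = u - P u := by abel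
    rw [hdiff]
    -- `‖u - P u‖² = Re⟪u, u - P u⟫`
    have hsq : ‖u - P u‖ ^ 2 = RCLike.re ⟪u, u - P u⟫_𝕜 := by
      rw [← inner_self_eq_norm_sq (𝕜 := 𝕜), inner_sub_left, hPs, map_sub P, hP2, sub_self,
        inner_zero_right, sub_zero]
    -- `Re⟪u, u - P u⟫ = Re⟪u, Q η⟫`
    have hinner : ⟪u, u - P u⟫_𝕜 = ⟪u, Q η⟫_𝕜 := by
      have h1 : u - P u = η - (η - u + P u) := hdiff.symm
      have hζQ : Q (η - u + P u) = 0 := by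
        have h1' : Q (P u) = T u := by rw [hTapply, hQu]
        rw [map_add, map_sub, hQu, h1']
        have h2 : Q η - u + T u = Q η - (u - T u) := by abel
        rw [h2, hfix, sub_self]
      rw [h1, inner_sub_right]
      have h3 : ⟪u, η - u + P u⟫_𝕜 = 0 := by
        calc ⟪u, η - u + P u⟫_𝕜 = ⟪Q u, η - u + P u⟫_𝕜 := by rw [hQu]
          _ = ⟪u, Q (η - u + P u)⟫_𝕜 := hQs _ _
          _ = 0 := by rw [hζQ, inner_zero_right]
      rw [h3, sub_zero]
      calc ⟪u, η⟫_𝕜 = ⟪Q u, η⟫_𝕜 := by rw [hQu]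
        _ = ⟪u, Q η⟫_𝕜 := hQs _ _
    rw [hsq, hinner]
    have h4 : RCLike.re ⟪u, Q η⟫_𝕜 ≤ ‖u‖ * ‖Q η‖ := re_inner_le_norm u (Q η)
    have h1Λ : 0 < 1 - Λ := by linarith
    rw [le_div_iff₀ h1Λ]
    have h5 : ‖u‖ * ‖Q η‖ * (1 - Λ) ≤ ‖Q η‖ ^ 2 := by
      have := mul_le_mul_of_nonneg_right hu_norm (norm_nonneg (Q η))
      nlinarith [this]
    nlinarith [h4, h5, h1Λ]
  · -- invariance under operators commuting with `P` and `Q`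
    intro R hRP hRQ hRη
    have hRT : ∀ y, R (T y) = T (R y) := fun y => by
      rw [hTapply, hTapply, hRQ, hRP, hRQ]
    -- `(1 - T) (R u) = (1 - T) u`, hence `R u = u`
    have hRu : R u = u := by
      have h1 : (U : E →L[𝕜] E) (R u) = (U : E →L[𝕜] E) u := by
        rw [hUval, sub_apply, sub_apply, one_apply_eq_self, one_apply_eq_self, ← hRT, ← map_sub, hfix,
          hRQ, hRη]
      have h2 : ∀ y, (↑U⁻¹ : E →L[𝕜] E) ((U : E →L[𝕜] E) y) = y := fun y => by
        rw [← mul_apply_eq_comp, Units.inv_mul, one_apply_eq_self]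
      rw [← h2 (R u), h1, h2]
    rw [map_add, map_sub, hRη, hRu, hRP, hRu]

/-- **Corollary (distance form).**  Under the same hypotheses, for `η ∈ ker P` and any closed subspace `K`
containing every `ζ` with `Pζ = 0`, `Qζ = 0` that is fixed by the given commuting family — packaged simply: if
`K` has an orthogonal projection and contains the `ζ` produced above — the orthogonal projection `π_K η` satisfies
`‖η − π_K η‖² ≤ ‖Qη‖²/(1 − Λ)`.  Stated in the form used downstream: for a complete submodule `K` with
`{ζ | Pζ = 0 ∧ Qζ = 0 ∧ Rζ = ζ} ⊆ K` for one operator `R` commuting with `P`, `Q` and fixing `η`. [folklore] -/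
theorem norm_sub_starProjection_sq_le (P Q R : E →L[𝕜] E) (hP2 : ∀ x, P (P x) = P x)
    (hPs : ∀ x y, ⟪P x, y⟫_𝕜 = ⟪x, P y⟫_𝕜) (hQ2 : ∀ x, Q (Q x) = Q x)
    (hQs : ∀ x y, ⟪Q x, y⟫_𝕜 = ⟪x, Q y⟫_𝕜) {Λ : ℝ} (hΛ0 : 0 ≤ Λ) (hΛ1 : Λ < 1)
    (hPQ : ∀ x, ‖Q (P x)‖ ^ 2 ≤ Λ * ‖P x‖ ^ 2)
    (hRP : ∀ x, R (P x) = P (R x)) (hRQ : ∀ x, R (Q x) = Q (R x))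
    (K : Submodule 𝕜 E) [K.HasOrthogonalProjection]
    (hK : ∀ ζ : E, P ζ = 0 → Q ζ = 0 → R ζ = ζ → ζ ∈ K)
    (η : E) (hη : P η = 0) (hRη : R η = η) :
    ‖η - K.starProjection η‖ ^ 2 ≤ ‖Q η‖ ^ 2 / (1 - Λ) := by
  obtain ⟨ζ, hPζ, hQζ, hest, hinv⟩ :=
    exists_mem_ker_inter_ker_norm_sub_sq_le P Q hP2 hPs hQ2 hQs hΛ0 hΛ1 hPQ η hη
  have hζK : ζ ∈ K := hK ζ hPζ hQζ (hinv R hRP hRQ hRη)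
  have hmin : ‖η - K.starProjection η‖ ≤ ‖η - ζ‖ := by
    rw [Submodule.starProjection_minimal]
    have hb : BddBelow (Set.range fun x : K => ‖η - (x : E)‖) :=
      ⟨0, by rintro _ ⟨x, rfl⟩; exact norm_nonneg _⟩
    exact ciInf_le hb ⟨ζ, hζK⟩
  calc ‖η - K.starProjection η‖ ^ 2 ≤ ‖η - ζ‖ ^ 2 := by
        gcongr
    _ ≤ ‖Q η‖ ^ 2 / (1 - Λ) := hest

end Summit.RiemannHypothesis.RiemannHypothesis.SoninDistance
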